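import Summits.MatrixMultiplication.MatrixMultiplication.Theorems.EdgePencilPairFactor
import Summits.MatrixMultiplication.MatrixMultiplication.Theorems.EdgePencilDualReading
import HarnessLib

/-!
# The sixth-edge ladder IS the asymptotic rank of one tensor: `n^{χ(log_n e)} = R̃[W_n^{(e)}]`, and the
# leaf `TetraExcessZero ⟺ R̃[T(K₄)_n] ≤ R̃[D_n]` at any single base

Support kernel for `stmt-MatrixMultiplication-26697` (`TetraExcessZero : ω(K₄) ≤ ω(2,1,2)`, route
`TetrahedronCarving`; cut of record `closes (TetraExcessZero) (TetraPlusTwo) : ω = 2`, UNCHANGED; lineage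
`decomp-mm-lens-6`, generation 44). No item is added or changed; no definition is introduced. Notation as in
`EdgePencilTropicalPair` / `EdgePencilPairFactor`: `W_n^{(e)} = sixTetra F n e`, `D_n = W_n^{(1)}`,
`T(K₄)_n = tetra F n = W_n^{(n)}`, `T₄(F) = DTensorClass F 4`, `X₄(F) = DTensorClass.asymptoticSpectrumDTensors F 2`,
`[t] = DTensorClass.mk t`, `R̃ = asympRankOf (· ≤ ·)` (the tree's abstract asymptotic rank of `T₄(F)`; by
Strassen duality `R̃(x) = max_{φ ∈ X₄} φ(x)`, the maximum ATTAINED: `DTensorClass.le_asympRankOf`,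
`DTensorClass.exists_mem_spectrum_apply_eq_asympRankOf`), `χ(δ) = omegaSix F δ`, `ψ = ω(2,1,2) = χ(0)`,
`ω(K₄) = omegaTetra F = χ(1)`.

§16 THE POINT LAW (`spectrum_sixTetra_le_rpow_omegaSix`): every `φ ∈ X₄(F)` is a lower reading of the pencil
in the sense of `EdgePencilDualReading.PencilReading` (generation 40 typed readings abstractly because the tree
then had no `X₄`; it has one now, `DTensorStrassenPreorder`), so `φ[W_n^{(e)}] ≤ n^{χ(δ)}` for `1 ≤ e ≤ n^δ`,
`δ ≤ 1`; in particular `φ[T(K₄)_n] ≤ n^{ω(K₄)}` and `φ[D_n] ≤ n^{ψ}`; at a maximiser, `R̃[W_n^{(e)}] ≤ n^{χ(δ)}`.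

§17 THE LADDER AS ONE NUMBER (`rpow_omegaSix_logb_eq_asympRank`, `2 ≤ n`, `1 ≤ e ≤ n`):

  `n^{χ(log_n e)} = R̃[W_n^{(e)}]`,   `n^{ω(K₄)} = R̃[T(K₄)_n]`,   `n^{ψ} = R̃[D_n]`

(`≥`: the point law at a maximiser; `≤`: if `R̃[W] < n^{θ}` then some power `[W]^{k+1} = [W_N^{(E)}]`
(`N = n^{k+1}`, `E = e^{k+1}`, `mk_sixTetra_pow`) has rank `≤ N^{θ}`, so `R₄(W_{N^{j+1}}^{(E^{j+1})}) ≤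
(N^{θ})^{j+1}` for all `j` and `omegaSix_le_of_levels` at base `N` (`⌈N^{log_n e}⌉ = E`) gives
`χ(log_n e) ≤ θ`). Hence EVERY rung of the ladder, the leaf included, is ONE (in)equality between the
asymptotic ranks of TWO EXPLICIT FINITE 4-TENSORS at any single base `n ≥ 2`:

  `χ(log_n e) ≤ ψ ⟺ R̃[W_n^{(e)}] ≤ R̃[D_n] ⟺ R̃[W_n^{(e)}] = R̃[D_n]`    (`sixRung_iff_asympRank_le/eq`),
  `TetraExcessZero ⟺ R̃[T(K₄)_n] ≤ R̃[D_n]` over `ℂ`   (`tetraExcessZero_iff_asympRank_le`), e.g.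
  `TetraExcessZero ⟺ R̃[T(K₄)_2] = R̃[D_2]`   (`tetraExcessZero_iff_asympRank_two`: formats `(8,8,8,8)` and,
  after trimming the trivial bond, `(4,4,8,8)`);  `TetraFlat ⟺ R̃[T(K₄)_2] = 16`;  `HalfAlpha ⟺ R̃[D_2] = 16`.

The exact two-sided DUAL reading of these (in)equalities on `X₄` (blind maximal points) and the
E-coordinates are the sequel `EdgePencilBlindMaximal`.

References: Strassen 1988, Thm. 3.8 (`R̃ = max` over the asymptotic spectrum) [Strassen1988]; Zuiddam 2018,
§2.8, Thm. 2.12, Cor. 2.13 [Zuiddam2018]; Christandl–Vrana–Zuiddam 2023, Thm. 1.1, Prop. 1.6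
[ChristandlVranaZuiddam2023]; Christandl–Vrana–Zuiddam, arXiv:1609.07476, §1.1, Prop. 1.1.16
[ChristandlVranaZuiddam2016]; Le Gall 2012, §1 (`α`) [LeGall2012]. No `sorry`, no new axiom, no instance,
no notation, no definition.
-/

noncomputable section

set_option linter.dupNamespace false

open Filter Finset Literature.Computability.AlgebraicComplexity
open Summit.MatrixMultiplication.MatrixMultiplication.Theorems.TetrahedronTensor
open Summit.MatrixMultiplication.MatrixMultiplication.Theorems.TetraDiagonal
open Summit.MatrixMultiplication.MatrixMultiplication.Theses.TetrahedronCarving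

namespace Summit.MatrixMultiplication.MatrixMultiplication.Theorems.EdgePencil

/-! ## §16 The point law: spectral points never beat the ladder -/

section PointLaw

variable (F : Type) [Field F]

/-- **Every spectral point obeys the reading law**: `φ[W_n^{(e)}] ≤ n^{χ(δ)}` for `φ ∈ X₄(F)`,
`1 ≤ e ≤ n^δ`, `δ ≤ 1`, `n ≥ 1` — the table `(n, e) ↦ φ[W_n^{(e)}]` is a `PencilReading` (sub-rank
`φ ≤ R`, multiplicative along `[W_n^{(e)}]·[W_m^{(f)}] = [W_{nm}^{(ef)}]`, bond-monotone), and
`PencilReading.val_le_rpow_omegaSix` applies. [cite: Strassen1988, Thm. 3.8] -/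
theorem spectrum_sixTetra_le_rpow_omegaSix {n e : ℕ} (hn : 1 ≤ n) (he : 1 ≤ e) {δ : ℝ} (hδ1 : δ ≤ 1)
    (heδ : (e : ℝ) ≤ (n : ℝ) ^ δ) {φ : DTensorClass F 4 → ℝ}
    (hφ : φ ∈ DTensorClass.asymptoticSpectrumDTensors F 2) :
    φ (DTensorClass.mk (sixTetra F n e)) ≤ (n : ℝ) ^ omegaSix F δ := by
  have hSP : IsStrassenPreorder (fun x y : DTensorClass F 4 => x ≤ y) :=
    DTensorClass.isStrassenPreorder F 2
  have hφ' := DTensorClass.mem_asymptoticSpectrumDTensors_iff.1 hφ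
  let R : PencilReading F :=
    { val := fun m f => φ (DTensorClass.mk (sixTetra F m f))
      nonneg := fun m f => hφ'.nonneg hSP _
      le_rank := fun m f _ => by
        show φ (DTensorClass.mk (sixTetra F m f)) ≤ (tensorRankD (sixTetra F m f) : ℝ)
        have h := hφ'.le_rankOf hSP (DTensorClass.mk (sixTetra F m f))
        rwa [rankOf_mk_sixTetra] at h
      supermul := fun m m' f f' hf hf' => by
        show φ (DTensorClass.mk (sixTetra F m f)) * φ (DTensorClass.mk (sixTetra F m' f')) ≤
          φ (DTensorClass.mk (sixTetra F (m * m') (f * f')))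
        rw [← hφ'.map_mul, mk_sixTetra_mul hf hf']
      mono := fun m f f' hff' => hφ'.mono (mk_sixTetra_mono hff') }
  exact R.val_le_rpow_omegaSix hn he hδ1 heδ

/-- At the natural bond: `φ[W_n^{(e)}] ≤ n^{χ(log_n e)}` (`2 ≤ n`, `1 ≤ e ≤ n`). [cite: Strassen1988, Thm. 3.8] -/
theorem spectrum_sixTetra_le_rpow_omegaSix_logb {n e : ℕ} (hn : 2 ≤ n) (he1 : 1 ≤ e) (he : e ≤ n)
    {φ : DTensorClass F 4 → ℝ} (hφ : φ ∈ DTensorClass.asymptoticSpectrumDTensors F 2) :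
    φ (DTensorClass.mk (sixTetra F n e)) ≤ (n : ℝ) ^ omegaSix F (Real.logb n e) := by
  have hn1' : (1 : ℝ) < n := by exact_mod_cast (show 1 < n by omega)
  have hn0 : (0 : ℝ) < n := by linarith
  have he0 : (0 : ℝ) < e := by exact_mod_cast he1
  have hδ1 : Real.logb n e ≤ 1 := by
    rw [← Real.logb_self_eq_one hn1']
    exact Real.logb_le_logb_of_le hn1' he0 (by exact_mod_cast he)
  refine spectrum_sixTetra_le_rpow_omegaSix F (by omega) he1 hδ1 ?_ hφ
  rw [Real.rpow_logb hn0 hn1'.ne' he0]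

/-- **`φ[T(K₄)_n] ≤ n^{ω(K₄)}`** for every `φ ∈ X₄(F)`, `n ≥ 1`. [cite: ChristandlVranaZuiddam2016, Def. 1.1.13] -/
theorem spectrum_tetra_le_rpow_omegaTetra {n : ℕ} (hn : 1 ≤ n) {φ : DTensorClass F 4 → ℝ}
    (hφ : φ ∈ DTensorClass.asymptoticSpectrumDTensors F 2) :
    φ (DTensorClass.mk (tetra F n)) ≤ (n : ℝ) ^ omegaTetra F := by
  have h := spectrum_sixTetra_le_rpow_omegaSix F hn hn (δ := 1) le_rfl (by rw [Real.rpow_one]) hφ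
  rwa [sixTetra_of_le le_rfl, omegaSix_one] at h

/-- **`φ[D_n] ≤ n^{ψ}`** (`ψ = ω(2,1,2)`) for every `φ ∈ X₄(F)`, `n ≥ 1`. [cite: ChristandlVranaZuiddam2016, Def. 1.1.13] -/
theorem spectrum_diamond_le_rpow_omegaRect {n : ℕ} (hn : 1 ≤ n) {φ : DTensorClass F 4 → ℝ}
    (hφ : φ ∈ DTensorClass.asymptoticSpectrumDTensors F 2) :
    φ (DTensorClass.mk (sixTetra F n 1)) ≤ (n : ℝ) ^ omegaRect F 2 1 2 := by
  have h := spectrum_sixTetra_le_rpow_omegaSix F hn le_rfl (δ := 0) zero_le_one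
    (by rw [Real.rpow_zero, Nat.cast_one]) hφ
  rwa [omegaSix_zero] at h

/-- **`R̃[W_n^{(e)}] ≤ n^{χ(δ)}`** (`1 ≤ e ≤ n^δ`, `δ ≤ 1`): the point law at a maximiser
(`R̃ = max_φ φ`, attained). [cite: Zuiddam2018, Cor. 2.13] -/
theorem asympRank_sixTetra_le_rpow_omegaSix {n e : ℕ} (hn : 1 ≤ n) (he : 1 ≤ e) {δ : ℝ} (hδ1 : δ ≤ 1)
    (heδ : (e : ℝ) ≤ (n : ℝ) ^ δ) :
    asympRankOf (fun x y : DTensorClass F 4 => x ≤ y) (DTensorClass.mk (sixTetra F n e)) ≤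
      (n : ℝ) ^ omegaSix F δ := by
  obtain ⟨φ, hφ, hφeq⟩ :=
    DTensorClass.exists_mem_spectrum_apply_eq_asympRankOf (DTensorClass.mk (sixTetra F n e))
  rw [← hφeq]
  exact spectrum_sixTetra_le_rpow_omegaSix F hn he hδ1 heδ hφ

/-- `1 ≤ R̃[W_n^{(e)}]` (`1 ≤ n`, `1 ≤ e`). [cite: Zuiddam2018, §2.8] -/
theorem one_le_asympRank_sixTetra {n e : ℕ} (hn : 1 ≤ n) (he : 1 ≤ e) :
    1 ≤ asympRankOf (fun x y : DTensorClass F 4 => x ≤ y) (DTensorClass.mk (sixTetra F n e)) := by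
  obtain ⟨φ, hφ, hφeq⟩ :=
    DTensorClass.exists_mem_spectrum_apply_eq_asympRankOf (DTensorClass.mk (sixTetra F n e))
  rw [← hφeq]
  exact one_le_spectrum_sixTetra hn he hφ

end PointLaw

/-! ## §17 The ladder as the asymptotic rank of one tensor -/

section OneNumber

variable (F : Type) [Field F]

/-- **`n^{χ(log_n e)} ≤ R̃[W_n^{(e)}]`** (`2 ≤ n`, `1 ≤ e ≤ n`): if `R̃[W] < n^{θ}` then some power
`[W]^{k+1} = [W_{N}^{(E)}]` (`N = n^{k+1}`, `E = e^{k+1}`, `mk_sixTetra_pow`) has rank `≤ N^{θ}`, hence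
`R₄(W_{N^{j+1}}^{(E^{j+1})}) ≤ (N^{θ})^{j+1}` for all `j` (`R(a^{j+1}) ≤ R(a)^{j+1}`), and
`omegaSix_le_of_levels` at base `N` (`⌈N^{log_n e}⌉ = E`) gives `χ(log_n e) ≤ θ`. [cite: Zuiddam2018, §2.8] -/
theorem rpow_omegaSix_logb_le_asympRank {n e : ℕ} (hn : 2 ≤ n) (he1 : 1 ≤ e) (he : e ≤ n) :
    (n : ℝ) ^ omegaSix F (Real.logb n e) ≤
      asympRankOf (fun x y : DTensorClass F 4 => x ≤ y) (DTensorClass.mk (sixTetra F n e)) := by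
  have hSP : IsStrassenPreorder (fun x y : DTensorClass F 4 => x ≤ y) :=
    DTensorClass.isStrassenPreorder F 2
  have hn1' : (1 : ℝ) < n := by exact_mod_cast (show 1 < n by omega)
  have hn0 : (0 : ℝ) < n := by linarith
  set x : ℝ := asympRankOf (fun x y : DTensorClass F 4 => x ≤ y) (DTensorClass.mk (sixTetra F n e))
    with hx
  have hx1 : 1 ≤ x := one_le_asympRank_sixTetra F (by omega) he1
  have hx0 : 0 < x := by linarith
  suffices h : omegaSix F (Real.logb n e) ≤ Real.logb n x by
    calc (n : ℝ) ^ omegaSix F (Real.logb n e) ≤ (n : ℝ) ^ Real.logb n x :=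
          Real.rpow_le_rpow_of_exponent_le hn1'.le h
      _ = x := Real.rpow_logb hn0 hn1'.ne' hx0
  have hθ0 : 0 ≤ Real.logb n x := Real.logb_nonneg hn1' hx1
  have hδ0 : 0 ≤ Real.logb n e := Real.logb_nonneg hn1' (by exact_mod_cast he1)
  refine le_of_forall_pos_le_add fun η hη => ?_
  -- `x < n^{θ + η}`, so some term of the infimum defining `R̃` is below `n^{θ+η}`
  have hlt : x < (n : ℝ) ^ (Real.logb n x + η) := by
    calc x = (n : ℝ) ^ Real.logb n x := (Real.rpow_logb hn0 hn1'.ne' hx0).symm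
      _ < (n : ℝ) ^ (Real.logb n x + η) := Real.rpow_lt_rpow_of_exponent_lt hn1' (by linarith)
  have hinf : (⨅ N : ℕ, ((rankOf (fun x y : DTensorClass F 4 => x ≤ y)
      (DTensorClass.mk (sixTetra F n e) ^ (N + 1)) : ℝ) ^ ((N : ℝ) + 1)⁻¹)) <
      (n : ℝ) ^ (Real.logb n x + η) := by
    rw [hx, asympRankOf] at hlt
    exact hlt
  obtain ⟨k, hk⟩ := exists_lt_of_ciInf_lt hinf
  -- the base `N = n^{k+1}` with bond `E = e^{k+1}`
  have hEN : e ^ (k + 1) ≤ n ^ (k + 1) := Nat.pow_le_pow_left he _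
  have hN2 : 2 ≤ n ^ (k + 1) :=
    le_trans hn (by simpa using Nat.pow_le_pow_right (by omega : 1 ≤ n) (Nat.succ_le_succ k.zero_le))
  have hN0 : (0 : ℝ) ≤ ((n ^ (k + 1) : ℕ) : ℝ) := Nat.cast_nonneg _
  -- rank of `W_N^{(E)}` below `N^{θ+η}`
  have hR : (tensorRankD (sixTetra F (n ^ (k + 1)) (e ^ (k + 1))) : ℝ) ≤
      (((n ^ (k + 1) : ℕ) : ℝ)) ^ (Real.logb n x + η) := by
    have h0 : 0 ≤ ((rankOf (fun x y : DTensorClass F 4 => x ≤ y)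
        (DTensorClass.mk (sixTetra F n e) ^ (k + 1)) : ℕ) : ℝ) := Nat.cast_nonneg _
    have hk1 : (0 : ℝ) < (k : ℝ) + 1 := by positivity
    have h1 := Real.rpow_le_rpow (Real.rpow_nonneg h0 _) hk.le hk1.le
    rw [← Real.rpow_mul h0, inv_mul_cancel₀ hk1.ne', Real.rpow_one, ← Real.rpow_mul hn0.le] at h1
    rw [mk_sixTetra_pow he k, rankOf_mk_sixTetra] at h1
    refine h1.trans (le_of_eq ?_)
    rw [Nat.cast_pow, ← Real.rpow_natCast_mul hn0.le]
    congr 1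
    push_cast
    ring
  refine omegaSix_le_of_levels F hN2 hδ0 (by linarith) (IsSubexponential.const 1) fun j => ?_
  rw [rectDim_pow_logb hn he1 k, Nat.cast_one, one_mul]
  have h2 : tensorRankD (sixTetra F ((n ^ (k + 1)) ^ (j + 1)) ((e ^ (k + 1)) ^ (j + 1))) ≤
      tensorRankD (sixTetra F (n ^ (k + 1)) (e ^ (k + 1))) ^ (j + 1) := by
    rw [← rankOf_mk_sixTetra, ← mk_sixTetra_pow hEN j, ← rankOf_mk_sixTetra]
    exact hSP.rankOf_pow_le _ _
  calc (tensorRankD (sixTetra F ((n ^ (k + 1)) ^ (j + 1)) ((e ^ (k + 1)) ^ (j + 1))) : ℝ)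
      ≤ ((tensorRankD (sixTetra F (n ^ (k + 1)) (e ^ (k + 1))) : ℝ)) ^ (j + 1) := by
        exact_mod_cast h2
    _ ≤ ((((n ^ (k + 1) : ℕ) : ℝ)) ^ (Real.logb n x + η)) ^ (j + 1) :=
        pow_le_pow_left₀ (Nat.cast_nonneg _) hR _

/-- **THE LADDER AS ONE NUMBER**: `n^{χ(log_n e)} = R̃[W_n^{(e)}]` (`2 ≤ n`, `1 ≤ e ≤ n`).
[cite: Zuiddam2018, Cor. 2.13] -/
theorem rpow_omegaSix_logb_eq_asympRank {n e : ℕ} (hn : 2 ≤ n) (he1 : 1 ≤ e) (he : e ≤ n) :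
    (n : ℝ) ^ omegaSix F (Real.logb n e) =
      asympRankOf (fun x y : DTensorClass F 4 => x ≤ y) (DTensorClass.mk (sixTetra F n e)) := by
  have hn1' : (1 : ℝ) < n := by exact_mod_cast (show 1 < n by omega)
  have hn0 : (0 : ℝ) < n := by linarith
  have he0 : (0 : ℝ) < e := by exact_mod_cast he1
  have hδ1 : Real.logb n e ≤ 1 := by
    rw [← Real.logb_self_eq_one hn1']
    exact Real.logb_le_logb_of_le hn1' he0 (by exact_mod_cast he)
  refine le_antisymm (rpow_omegaSix_logb_le_asympRank F hn he1 he)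
    (asympRank_sixTetra_le_rpow_omegaSix F (by omega) he1 hδ1 ?_)
  rw [Real.rpow_logb hn0 hn1'.ne' he0]

/-- **`χ(log_n e) = log_n R̃[W_n^{(e)}]`** (`2 ≤ n`, `1 ≤ e ≤ n`). [cite: Zuiddam2018, Cor. 2.13] -/
theorem omegaSix_logb_eq_logb_asympRank {n e : ℕ} (hn : 2 ≤ n) (he1 : 1 ≤ e) (he : e ≤ n) :
    omegaSix F (Real.logb n e) =
      Real.logb n (asympRankOf (fun x y : DTensorClass F 4 => x ≤ y) (DTensorClass.mk (sixTetra F n e))) := by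
  have hn1' : (1 : ℝ) < n := by exact_mod_cast (show 1 < n by omega)
  have hn0 : (0 : ℝ) < n := by linarith
  rw [← rpow_omegaSix_logb_eq_asympRank F hn he1 he, Real.logb_rpow hn0 hn1'.ne']

/-- **`n^{ω(K₄)} = R̃[T(K₄)_n]`** (`2 ≤ n`). [cite: ChristandlVranaZuiddam2016, Prop. 1.1.16] -/
theorem rpow_omegaTetra_eq_asympRank {n : ℕ} (hn : 2 ≤ n) :
    (n : ℝ) ^ omegaTetra F =
      asympRankOf (fun x y : DTensorClass F 4 => x ≤ y) (DTensorClass.mk (tetra F n)) := by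
  have hn1' : (1 : ℝ) < n := by exact_mod_cast (show 1 < n by omega)
  have h := rpow_omegaSix_logb_eq_asympRank F hn (by omega : 1 ≤ n) le_rfl
  rwa [Real.logb_self_eq_one hn1', omegaSix_one, sixTetra_of_le le_rfl] at h

/-- **`ω(K₄) = log_n R̃[T(K₄)_n]`** (`2 ≤ n`). [cite: ChristandlVranaZuiddam2016, Prop. 1.1.16] -/
theorem omegaTetra_eq_logb_asympRank {n : ℕ} (hn : 2 ≤ n) :
    omegaTetra F =
      Real.logb n (asympRankOf (fun x y : DTensorClass F 4 => x ≤ y) (DTensorClass.mk (tetra F n))) := by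
  have hn1' : (1 : ℝ) < n := by exact_mod_cast (show 1 < n by omega)
  have hn0 : (0 : ℝ) < n := by linarith
  rw [← rpow_omegaTetra_eq_asympRank F hn, Real.logb_rpow hn0 hn1'.ne']

/-- **`n^{ψ} = R̃[D_n]`** (`ψ = ω(2,1,2)`, `2 ≤ n`). [cite: ChristandlVranaZuiddam2016, Prop. 1.1.16] -/
theorem rpow_omegaRect_eq_asympRank_diamond {n : ℕ} (hn : 2 ≤ n) :
    (n : ℝ) ^ omegaRect F 2 1 2 =
      asympRankOf (fun x y : DTensorClass F 4 => x ≤ y) (DTensorClass.mk (sixTetra F n 1)) := by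
  have h := rpow_omegaSix_logb_eq_asympRank F hn le_rfl (by omega : 1 ≤ n)
  rwa [Nat.cast_one, Real.logb_one, omegaSix_zero] at h

/-- **`ψ = log_n R̃[D_n]`** (`2 ≤ n`). [cite: ChristandlVranaZuiddam2016, Prop. 1.1.16] -/
theorem omegaRect_eq_logb_asympRank_diamond {n : ℕ} (hn : 2 ≤ n) :
    omegaRect F 2 1 2 =
      Real.logb n (asympRankOf (fun x y : DTensorClass F 4 => x ≤ y) (DTensorClass.mk (sixTetra F n 1))) := by
  have hn1' : (1 : ℝ) < n := by exact_mod_cast (show 1 < n by omega)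
  have hn0 : (0 : ℝ) < n := by linarith
  rw [← rpow_omegaRect_eq_asympRank_diamond F hn, Real.logb_rpow hn0 hn1'.ne']

/-- `R̃[D_n] ≤ R̃[W_n^{(e)}]` (`1 ≤ e`; `[D_n] ≤ [W_n^{(e)}]`). [cite: Zuiddam2018, §2.8] -/
theorem asympRank_diamond_le_sixTetra (n : ℕ) {e : ℕ} (he : 1 ≤ e) :
    asympRankOf (fun x y : DTensorClass F 4 => x ≤ y) (DTensorClass.mk (sixTetra F n 1)) ≤
      asympRankOf (fun x y : DTensorClass F 4 => x ≤ y) (DTensorClass.mk (sixTetra F n e)) :=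
  (DTensorClass.isStrassenPreorder F 2).asympRankOf_mono (mk_sixTetra_mono he)

/-- **A RUNG IS ONE INEQUALITY OF ASYMPTOTIC RANKS**: `χ(log_n e) ≤ ψ ⟺ R̃[W_n^{(e)}] ≤ R̃[D_n]`
(`2 ≤ n`, `1 ≤ e ≤ n`). [cite: Zuiddam2018, Cor. 2.13] -/
theorem sixRung_iff_asympRank_le {n e : ℕ} (hn : 2 ≤ n) (he1 : 1 ≤ e) (he : e ≤ n) :
    omegaSix F (Real.logb n e) ≤ omegaRect F 2 1 2 ↔
      asympRankOf (fun x y : DTensorClass F 4 => x ≤ y) (DTensorClass.mk (sixTetra F n e)) ≤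
        asympRankOf (fun x y : DTensorClass F 4 => x ≤ y) (DTensorClass.mk (sixTetra F n 1)) := by
  have hn1' : (1 : ℝ) < n := by exact_mod_cast (show 1 < n by omega)
  rw [← Real.rpow_le_rpow_left_iff hn1', rpow_omegaSix_logb_eq_asympRank F hn he1 he,
    rpow_omegaRect_eq_asympRank_diamond F hn]

/-- … equivalently an EQUALITY `R̃[W_n^{(e)}] = R̃[D_n]`. [cite: Zuiddam2018, Cor. 2.13] -/
theorem sixRung_iff_asympRank_eq {n e : ℕ} (hn : 2 ≤ n) (he1 : 1 ≤ e) (he : e ≤ n) :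
    omegaSix F (Real.logb n e) ≤ omegaRect F 2 1 2 ↔
      asympRankOf (fun x y : DTensorClass F 4 => x ≤ y) (DTensorClass.mk (sixTetra F n e)) =
        asympRankOf (fun x y : DTensorClass F 4 => x ≤ y) (DTensorClass.mk (sixTetra F n 1)) := by
  rw [sixRung_iff_asympRank_le F hn he1 he]
  exact ⟨fun h => le_antisymm h (asympRank_diamond_le_sixTetra F n he1), fun h => h.le⟩

/-- **`ExcessZero` at one base**: `ω(K₄) ≤ ψ ⟺ R̃[T(K₄)_n] ≤ R̃[D_n]` (`2 ≤ n`). [cite: Zuiddam2018, Cor. 2.13] -/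
theorem excessZero_iff_asympRank_le {n : ℕ} (hn : 2 ≤ n) :
    omegaTetra F ≤ omegaRect F 2 1 2 ↔
      asympRankOf (fun x y : DTensorClass F 4 => x ≤ y) (DTensorClass.mk (tetra F n)) ≤
        asympRankOf (fun x y : DTensorClass F 4 => x ≤ y) (DTensorClass.mk (sixTetra F n 1)) := by
  have hn1' : (1 : ℝ) < n := by exact_mod_cast (show 1 < n by omega)
  have h := sixRung_iff_asympRank_le F hn (by omega : 1 ≤ n) le_rfl
  rwa [Real.logb_self_eq_one hn1', omegaSix_one, sixTetra_of_le le_rfl] at h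

/-- **THE LEAF AS ONE INEQUALITY, BY NAME**: `TetraExcessZero ⟺ R̃[T(K₄)_n] ≤ R̃[D_n]` over `ℂ`, at
any single base `n ≥ 2`. [cite: Zuiddam2018, Cor. 2.13] -/
theorem tetraExcessZero_iff_asympRank_le {n : ℕ} (hn : 2 ≤ n) :
    TetraExcessZero ↔
      asympRankOf (fun x y : DTensorClass ℂ 4 => x ≤ y) (DTensorClass.mk (tetra ℂ n)) ≤
        asympRankOf (fun x y : DTensorClass ℂ 4 => x ≤ y) (DTensorClass.mk (sixTetra ℂ n 1)) :=
  excessZero_iff_asympRank_le ℂ hn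

/-- **THE LEAF AT BASE 2**: `TetraExcessZero ⟺ R̃[T(K₄)_2] = R̃[D_2]` — the asymptotic ranks of the
4-tensors `T(K₄)_2` (format `(8,8,8,8)`) and `D_2` (format `(4,4,8,8)` after trimming the trivial bond).
[cite: Zuiddam2018, Cor. 2.13] -/
theorem tetraExcessZero_iff_asympRank_two :
    TetraExcessZero ↔
      asympRankOf (fun x y : DTensorClass ℂ 4 => x ≤ y) (DTensorClass.mk (tetra ℂ 2)) =
        asympRankOf (fun x y : DTensorClass ℂ 4 => x ≤ y) (DTensorClass.mk (sixTetra ℂ 2 1)) := by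
  have h := sixRung_iff_asympRank_eq ℂ le_rfl (by norm_num : 1 ≤ 2) le_rfl
  rw [Nat.cast_ofNat, Real.logb_self_eq_one (by norm_num : (1 : ℝ) < 2), omegaSix_one,
    sixTetra_of_le le_rfl] at h
  exact h

/-- **`TetraFlat ⟺ R̃[T(K₄)_n] ≤ n⁴`** (`2 ≤ n`). [cite: ChristandlVranaZuiddam2016, §1.2] -/
theorem tetraFlat_iff_asympRank_le {n : ℕ} (hn : 2 ≤ n) :
    TetraFlat ↔
      asympRankOf (fun x y : DTensorClass ℂ 4 => x ≤ y) (DTensorClass.mk (tetra ℂ n)) ≤ (n : ℝ) ^ 4 := by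
  have hn1' : (1 : ℝ) < n := by exact_mod_cast (show 1 < n by omega)
  show omegaTetra ℂ ≤ 4 ↔ _
  rw [← Real.rpow_le_rpow_left_iff hn1', rpow_omegaTetra_eq_asympRank ℂ hn,
    show ((n : ℝ) ^ (4 : ℝ)) = (n : ℝ) ^ (4 : ℕ) by exact_mod_cast Real.rpow_natCast (n : ℝ) 4]

/-- **`TetraFlat ⟺ R̃[T(K₄)_2] = 16`** (`16 = 2⁴ ≤ R̃[T(K₄)_2]` is the flattening floor `4 ≤ ω(K₄)`).
[cite: ChristandlVranaZuiddam2016, §1.2] -/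
theorem tetraFlat_iff_asympRank_two :
    TetraFlat ↔ asympRankOf (fun x y : DTensorClass ℂ 4 => x ≤ y) (DTensorClass.mk (tetra ℂ 2)) = 16 := by
  rw [tetraFlat_iff_asympRank_le le_rfl]
  have h16 : (16 : ℝ) ≤ asympRankOf (fun x y : DTensorClass ℂ 4 => x ≤ y) (DTensorClass.mk (tetra ℂ 2)) := by
    rw [← rpow_omegaTetra_eq_asympRank ℂ le_rfl, show (16 : ℝ) = (2 : ℝ) ^ (4 : ℝ) by norm_num]
    exact Real.rpow_le_rpow_of_exponent_le (by norm_num) (four_le_omegaTetra ℂ)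
  constructor
  · intro h
    exact le_antisymm (by norm_num at h ⊢; exact h) h16
  · intro h
    rw [h]
    norm_num

/-- **`HalfAlpha ⟺ R̃[D_n] ≤ n⁴`** (`2 ≤ n`; `HalfAlpha ⟺ ψ ≤ 4`). [cite: LeGall2012, §1] -/
theorem halfAlpha_iff_asympRank_diamond_le {n : ℕ} (hn : 2 ≤ n) :
    HalfAlpha ↔
      asympRankOf (fun x y : DTensorClass ℂ 4 => x ≤ y) (DTensorClass.mk (sixTetra ℂ n 1)) ≤ (n : ℝ) ^ 4 := by
  have hn1' : (1 : ℝ) < n := by exact_mod_cast (show 1 < n by omega)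
  show (1 / 2 : ℝ) ≤ dualExponentAlpha ℂ ↔ _
  rw [← omegaRect_two_one_two_le_four_iff_half_le_dualExponentAlpha ℂ,
    ← Real.rpow_le_rpow_left_iff hn1', rpow_omegaRect_eq_asympRank_diamond ℂ hn,
    show ((n : ℝ) ^ (4 : ℝ)) = (n : ℝ) ^ (4 : ℕ) by exact_mod_cast Real.rpow_natCast (n : ℝ) 4]

/-- **`HalfAlpha ⟺ R̃[D_2] = 16`.** [cite: LeGall2012, §1] -/
theorem halfAlpha_iff_asympRank_diamond_two :
    HalfAlpha ↔ asympRankOf (fun x y : DTensorClass ℂ 4 => x ≤ y) (DTensorClass.mk (sixTetra ℂ 2 1)) = 16 := by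
  rw [halfAlpha_iff_asympRank_diamond_le le_rfl]
  have h16 : (16 : ℝ) ≤
      asympRankOf (fun x y : DTensorClass ℂ 4 => x ≤ y) (DTensorClass.mk (sixTetra ℂ 2 1)) := by
    rw [← rpow_omegaRect_eq_asympRank_diamond ℂ le_rfl, show (16 : ℝ) = (2 : ℝ) ^ (4 : ℝ) by norm_num]
    exact Real.rpow_le_rpow_of_exponent_le (by norm_num) (four_le_omegaRect_two_one_two ℂ)
  constructor
  · intro h
    exact le_antisymm (by norm_num at h ⊢; exact h) h16
  · intro h
    rw [h]
    norm_num

end OneNumber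

end Summit.MatrixMultiplication.MatrixMultiplication.Theorems.EdgePencil

end
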